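import Mathlib
import HarnessLib
import Summits.Langlands.Langlands.Theorems.ParityBlindBianchiArtinWeightRealisationLevelRigidity
import Literature.NumberTheory.GaloisRepresentations.FramedRepDualIrreducible
import Literature.NumberTheory.GaloisRepresentations.ArtinRestriction

/-!
# The solvable sector of R′ = `ParityBlindBianchi.ArtinWeightRealisationLevel` (stmt-Langlands-15111)
needs no `p`-adic input: Langlands–Tunnell + Gelbart's Prop. 4.1 — helper file (`--supports`),
line `Sketch` (every-place-by-gamma-rigidity)

The lead composition (`ParityBlindBianchiArtinWeightRealisationLevel.lean`) derives R′ from the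
shared open crux R (`RuelleTorsionArtinWeight.ArtinWeightRealisation`, item stmt-Langlands-11057).
This file records, kernel-checked, the census line of the idea card: for `σ : Γ_K → GL₂(ℚ̄_p)` with
finite image, irreducible and with SOLVABLE projective image, the conclusion of R′ — indeed the
stronger "some cuspidal `π` of `GL₂(𝔸_K)` is Satake–Frobenius compatible with `σ` at EVERY place
where `σ` is unramified", with no tame level and no Hecke-point hypothesis at all — follows from the
Langlands–Tunnell theorem in automorphic form (the named fact `strongArtin_of_isSolvable` of
`Automorphic/StrongArtinGL2`: Jacquet–Langlands §12, Langlands 1980, Tunnell 1981; Gelbart 1997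
Thm. 2.1) and the σ-unramified shadow of Gelbart 1997 Prop. 4.1 (hypothesis written out, as in
`…Rigidity`).  So the dependence of R′ on R is confined to the insoluble (icosahedral) sector — the
route's instance and the wall.

Mechanism: the contragredient transport `τ = ι ∘ σ^∨ : Γ_K → GL₂(ℂ)` (`exists_map_ringEquiv` on
`FramedRep.dual σ`) is irreducible (dual: `FramedRep.isIrreducible_dual`; change of coefficients
along the field isomorphism `ι`: through the projective image, `not_isIrreducible_of_isCyclicType`
over `ℚ̄_p` and `isIrreducible_of_not_isCyclicType` over `ℂ`) with solvable projective image
(`FramedRep.isSolvable_range_dual`, `isSolvable_projectiveImage_iff`), so `π(τ)` exists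
(`strongArtin_of_isSolvable`: `IsPiOfArtinRep τ π`, a.e.); the pointwise dictionary
(`satakeFrobCompatibleAt_iff_of_dual_transport`, from the landed `stub_charpolyDictionary`) turns
this into a.e. `SatakeFrobCompatibleAt ι π σ`, and the landed rigidity
`satakeFrobCompatibleAt_of_eventually_of_isUnramifiedAt` upgrades it to every σ-unramified place.

* dual-transport API: `apply_eq_one_iff_of_dual_transport`, `isUnramifiedAt_iff_of_dual_transport`,
  `hasFrobCharpolyAt_iff_of_dual_transport`, `satakeFrobCompatibleAt_iff_of_dual_transport`,
  `exists_dual_transport_projectiveImage`, `isIrreducible_of_dual_transport`,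
  `isSolvable_projectiveImage_of_dual_transport`;
* `satakeFrobCompatibleAt_of_isSolvable_projectiveImage` — the solvable sector.

No definitions.
-/

noncomputable section

open scoped BigOperators Topology Classical Matrix NumberField MatrixGroups
open Literature.NumberTheory.Automorphic Literature.NumberTheory.GaloisRepresentations
  IsDedekindDomain NumberField Filter

-- `Summit.Langlands.Langlands.…`: summit = sub-problem name (D-0017 nested layout), not a typo.
set_option linter.dupNamespace false

namespace Summit.Langlands.Langlands.Theorems.ArtinWeightRealisationLevel

section DualTransportAPI

variable {K : Type} [Field K] [NumberField K] {p : ℕ} [Fact p.Prime] (ι : PadicAlgCl p ≃+* ℂ)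
  (σ : FramedGaloisRep K (PadicAlgCl p) 2) (τ : FramedArtinRep K 2)
  (hτ : ∀ g : Field.absoluteGaloisGroup K, ((τ g : GL (Fin 2) ℂ) : Matrix (Fin 2) (Fin 2) ℂ) =
    ((((σ g)⁻¹ : GL (Fin 2) (PadicAlgCl p)) : Matrix (Fin 2) (Fin 2) (PadicAlgCl p))ᵀ).map
      (ι : PadicAlgCl p → ℂ))

include hτ

omit [NumberField K] in
/-- For the contragredient transport `τ g = ι(((σ g)⁻¹)ᵀ)`: `τ g = 1 ↔ σ g = 1`. [folklore] -/
theorem apply_eq_one_iff_of_dual_transport (g : Field.absoluteGaloisGroup K) : τ g = 1 ↔ σ g = 1 := by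
  constructor
  · intro h
    have h1 : ((((σ g)⁻¹ : GL (Fin 2) (PadicAlgCl p)) : Matrix (Fin 2) (Fin 2) (PadicAlgCl p))ᵀ).map
        (ι : PadicAlgCl p → ℂ) = (1 : Matrix (Fin 2) (Fin 2) (PadicAlgCl p)).map (ι : PadicAlgCl p → ℂ) := by
      rw [← hτ g, h, Matrix.map_one _ (map_zero ι) (map_one ι)]
      rfl
    have h2 : (((σ g)⁻¹ : GL (Fin 2) (PadicAlgCl p)) : Matrix (Fin 2) (Fin 2) (PadicAlgCl p))ᵀ = 1 :=
      Matrix.map_injective ι.injective h1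
    have h3 : ((σ g)⁻¹ : GL (Fin 2) (PadicAlgCl p)) = 1 := by
      apply Units.ext
      rw [Units.val_one, ← Matrix.transpose_one, ← h2, Matrix.transpose_transpose]
    exact inv_eq_one.mp h3
  · intro h
    apply Units.ext
    rw [hτ g, h, inv_one, Units.val_one, Matrix.transpose_one,
      Matrix.map_one _ (map_zero ι) (map_one ι), Units.val_one]

omit [NumberField K] in
/-- The contragredient transport is unramified exactly where `σ` is. [folklore] -/
theorem isUnramifiedAt_iff_of_dual_transport (v : HeightOneSpectrum (𝓞 K)) :
    τ.IsUnramifiedAt v ↔ σ.IsUnramifiedAt v :=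
  forall₂_congr fun _ _ => forall₂_congr fun g _ => apply_eq_one_iff_of_dual_transport ι σ τ hτ g

/-- The Frobenius dictionary along the contragredient transport: `charpoly σ(Frob_v) =
∏ (X - ι⁻¹(a⁻¹))` iff `charpoly τ(Frob_v) = ∏ (X - a)` (the landed `stub_charpolyDictionary`,
placewise). [folklore] -/
theorem hasFrobCharpolyAt_iff_of_dual_transport (v : HeightOneSpectrum (𝓞 K)) (α : Multiset ℂ)
    (hα : Multiset.card α = 2) :
    σ.HasFrobCharpolyAt v (arithFrobPolyOfSatake ι v.residueCard 1 α) ↔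
      τ.HasFrobCharpolyAt v (satakePolynomial α) := by
  refine forall₂_congr fun _ _ => forall₂_congr fun g _ => ?_
  unfold FramedRep.charpoly
  rw [hτ g]
  exact stub_charpolyDictionary ι v.residueCard (σ g) α hα

/-- **The two compatibility conventions agree along the contragredient transport**: for the same
automorphic datum `π`, the summit's `SatakeFrobCompatibleAt ι π σ v` (`p`-adic `σ`,
`arithFrobPolyOfSatake ι q 1 α`) is Tunnell's `FrobSatakeCompatibleAt τ π v` (complex `τ = ι ∘ σ^∨`,
`satakePolynomial α`). [folklore] -/
theorem satakeFrobCompatibleAt_iff_of_dual_transport {hcpt : isCompact_glFiniteIntegralLevel 2 K}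
    (π : AutomorphicRepData (AutomorphyDatum.gl 2 K hcpt)) (v : HeightOneSpectrum (𝓞 K)) :
    Summit.Langlands.SatakeFrobCompatibleAt ι π σ v ↔ FrobSatakeCompatibleAt τ π v := by
  constructor
  · rintro ⟨α, hαπ, hunr, hchar⟩
    exact ⟨α, hαπ, (isUnramifiedAt_iff_of_dual_transport ι σ τ hτ v).2 hunr,
      (hasFrobCharpolyAt_iff_of_dual_transport ι σ τ hτ v α hαπ.card_eq).1 hchar⟩
  · rintro ⟨α, hαπ, hunr, hchar⟩
    exact ⟨α, hαπ, (isUnramifiedAt_iff_of_dual_transport ι σ τ hτ v).1 hunr,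
      (hasFrobCharpolyAt_iff_of_dual_transport ι σ τ hτ v α hαπ.card_eq).2 hchar⟩

end DualTransportAPI

section Transport

variable {K : Type} [Field K] [NumberField K] {p : ℕ} [Fact p.Prime]

omit [NumberField K] in
/-- **Contragredient transport with its projective image.**  For `σ : Γ_K → GL₂(ℚ̄_p)` continuous
with finite image and `ι : ℚ̄_p ≃+* ℂ` there is a framed Artin representation `τ : Γ_K → GL₂(ℂ)`
with `τ g = ι(((σ g)⁻¹)ᵀ)`, finite image, and projective image isomorphic to that of `σ^∨`
(`exists_map_ringEquiv` applied to `FramedRep.dual σ`). [folklore] -/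
theorem exists_dual_transport_projectiveImage (ι : PadicAlgCl p ≃+* ℂ)
    (σ : FramedGaloisRep K (PadicAlgCl p) 2) (hfin : Finite σ.toMonoidHom.range) :
    ∃ τ : FramedArtinRep K 2,
      (∀ g : Field.absoluteGaloisGroup K, ((τ g : GL (Fin 2) ℂ) : Matrix (Fin 2) (Fin 2) ℂ) =
        ((((σ g)⁻¹ : GL (Fin 2) (PadicAlgCl p)) : Matrix (Fin 2) (Fin 2) (PadicAlgCl p))ᵀ).map
          (ι : PadicAlgCl p → ℂ)) ∧
      Finite τ.toMonoidHom.range ∧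
      Nonempty (projectiveImage τ.toMonoidHom ≃* projectiveImage (FramedRep.dual σ).toMonoidHom) := by
  haveI : Finite (FramedRep.dual σ).toMonoidHom.range := by
    have h1 : (Set.range σ).Finite := by
      have : (σ.toMonoidHom.range : Set (GL (Fin 2) (PadicAlgCl p))) = Set.range σ := by
        rw [MonoidHom.coe_range]; rfl
      rw [← this]; exact Set.toFinite _
    have h2 := FramedRep.finite_range_dual σ h1
    have : ((FramedRep.dual σ).toMonoidHom.range : Set (GL (Fin 2) (PadicAlgCl p))) =
        Set.range (FramedRep.dual σ) := by
      rw [MonoidHom.coe_range]; rfl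
    exact Set.finite_coe_iff.mpr (this ▸ h2)
  obtain ⟨τ, hτ, hfinτ, he⟩ :=
    Summit.Langlands.Langlands.Theorems.ResidualBianchiDoorMod2.exists_map_ringEquiv
      (FramedRep.dual σ) ι
  refine ⟨τ, fun g => ?_, hfinτ, he⟩
  have h : τ.toMonoidHom g =
      ((Matrix.GeneralLinearGroup.map ι.toRingHom).comp (FramedRep.dual σ).toMonoidHom) g :=
    DFunLike.congr_fun hτ g
  change ((τ.toMonoidHom g : GL (Fin 2) ℂ) : Matrix (Fin 2) (Fin 2) ℂ) = _
  rw [h]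
  rfl

omit [NumberField K] in
/-- **Irreducibility transports along the contragredient transport** `σ ↦ τ = ι ∘ σ^∨`
(finite image, rank `2`): `σ^∨` is irreducible (`FramedRep.isIrreducible_dual`), hence not of
cyclic type over the algebraically closed `ℚ̄_p` (`not_isIrreducible_of_isCyclicType`); the
projective images of `τ` and `σ^∨` are isomorphic, so `τ` is not of cyclic type, hence irreducible
(`isIrreducible_of_not_isCyclicType`, finite image, characteristic `0`). [folklore] -/
theorem isIrreducible_of_dual_transport (σ : FramedGaloisRep K (PadicAlgCl p) 2)
    (hirr : σ.toGaloisRep.IsIrreducible) (τ : FramedArtinRep K 2) (hfinτ : Finite τ.toMonoidHom.range)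
    (e : projectiveImage τ.toMonoidHom ≃* projectiveImage (FramedRep.dual σ).toMonoidHom) :
    τ.toGaloisRep.IsIrreducible := by
  -- `σ^∨` is irreducible, hence not of cyclic type
  have hdual : (FramedRep.dual σ).IsIrreducible :=
    FramedRep.isIrreducible_dual σ ((FramedRep.isIrreducible_toContinuousRep_iff σ).1 hirr)
  have hnc : ¬ IsCyclicType (FramedRep.dual σ).toMonoidHom := by
    intro hc
    have h := not_isIrreducible_of_isCyclicType (FramedRep.dual σ).toMonoidHom hc
    rw [toStdRepresentation_toMonoidHom] at h
    exact h hdual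
  -- so `τ` is not of cyclic type
  have hncτ : ¬ IsCyclicType τ.toMonoidHom := by
    intro hc
    apply hnc
    unfold IsCyclicType at hc ⊢
    exact isCyclic_of_surjective e.toMonoidHom e.surjective
  haveI := hfinτ
  have h := isIrreducible_of_not_isCyclicType τ.toMonoidHom hncτ
  rw [toStdRepresentation_toMonoidHom] at h
  exact (FramedRep.isIrreducible_toContinuousRep_iff τ).2 h

omit [NumberField K] in
/-- **Solvability of the projective image transports along the contragredient transport**
(`isSolvable_projectiveImage_iff`, `FramedRep.isSolvable_range_dual`, and the isomorphism of
projective images). [folklore] -/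
theorem isSolvable_projectiveImage_of_dual_transport (σ : FramedGaloisRep K (PadicAlgCl p) 2)
    (hs : IsSolvable (projectiveImage σ.toMonoidHom)) (τ : FramedArtinRep K 2)
    (e : projectiveImage τ.toMonoidHom ≃* projectiveImage (FramedRep.dual σ).toMonoidHom) :
    IsSolvable (projectiveImage τ.toMonoidHom) := by
  haveI : IsSolvable σ.toMonoidHom.range := (isSolvable_projectiveImage_iff _).1 hs
  haveI : IsSolvable (FramedRep.dual σ).toMonoidHom.range := FramedRep.isSolvable_range_dual σ ‹_›
  haveI : IsSolvable (projectiveImage (FramedRep.dual σ).toMonoidHom) :=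
    (isSolvable_projectiveImage_iff _).2 ‹_›
  exact solvable_of_solvable_injective (f := e.toMonoidHom) e.injective

end Transport

/-- **The solvable sector: `SatakeFrobCompatibleAt` at every σ-unramified place from
Langlands–Tunnell and Gelbart's Prop. 4.1, with no `p`-adic hypothesis.**  Assume the
Langlands–Tunnell theorem in automorphic form (`hLT : strongArtin_of_isSolvable`, the named fact of
`Automorphic/StrongArtinGL2`) and the σ-unramified shadow of Gelbart 1997 Prop. 4.1 (`hG`, written
out; Literature named fact `frobSatakeCompatibleAt_of_isPiOfArtinRep_of_isUnramifiedAt`).  Then for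
every number field `K`, prime `p`, `ι : ℚ̄_p ≃+* ℂ` and `σ : Γ_K → GL₂(ℚ̄_p)` continuous with finite
image, irreducible, with solvable projective image (dihedral, tetrahedral or octahedral type),
there is a cuspidal `π` of `GL₂(𝔸_K)` with `SatakeFrobCompatibleAt ι π σ w` at EVERY finite place
`w` at which `σ` is unramified.  In particular the conclusion of
`ParityBlindBianchi.ArtinWeightRealisationLevel` holds for such `σ` without its hypothesis, and
the crux depends on the open item stmt-Langlands-11057 only in the insoluble (icosahedral) sector.
Proof: `π := π(τ)` for the contragredient transport `τ = ι ∘ σ^∨`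
(`exists_dual_transport_projectiveImage`, `isIrreducible_of_dual_transport`,
`isSolvable_projectiveImage_of_dual_transport`, `hLT`); `IsPiOfArtinRep τ π` is a.e.
`SatakeFrobCompatibleAt ι π σ` (`satakeFrobCompatibleAt_iff_of_dual_transport`), upgraded to every
σ-unramified place by `satakeFrobCompatibleAt_of_eventually_of_isUnramifiedAt hG`. [folklore] -/
theorem satakeFrobCompatibleAt_of_isSolvable_projectiveImage : strongArtin_of_isSolvable → (∀ {F : Type} [Field F] [NumberField F] (hcpt : isCompact_glFiniteIntegralLevel 2 F) (σ : FramedArtinRep F 2) (π : CuspidalAutomorphicRepData 2 F hcpt), IsPiOfArtinRep σ π.1 → ∀ v : HeightOneSpectrum (𝓞 F), σ.IsUnramifiedAt v → FrobSatakeCompatibleAt σ π.1 v) → ∀ (K : Type) [Field K] [NumberField K] (p : ℕ) [Fact p.Prime] (ι : PadicAlgCl p ≃+* ℂ) (σ : FramedGaloisRep K (PadicAlgCl p) 2), Finite σ.toMonoidHom.range → σ.toGaloisRep.IsIrreducible → IsSolvable (projectiveImage σ.toMonoidHom) → ∃ (hcpt : isCompact_glFiniteIntegralLevel 2 K) (π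 : CuspidalAutomorphicRepData 2 K hcpt), ∀ w : HeightOneSpectrum (𝓞 K), σ.IsUnramifiedAt w → Summit.Langlands.SatakeFrobCompatibleAt ι π.1 σ w := by
  intro hLT hG K _ _ p _ ι σ hfin hirr hsolv
  obtain ⟨τ, hτ, hfinτ, ⟨e⟩⟩ := exists_dual_transport_projectiveImage ι σ hfin
  have hirrτ : τ.toGaloisRep.IsIrreducible := isIrreducible_of_dual_transport σ hirr τ hfinτ e
  have hsolvτ : IsSolvable (projectiveImage τ.toMonoidHom) :=
    isSolvable_projectiveImage_of_dual_transport σ hsolv τ e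
  obtain ⟨hcpt, π, hpi⟩ := hLT τ hirrτ hsolvτ
  have hae : ∀ᶠ w : HeightOneSpectrum (𝓞 K) in cofinite,
      Summit.Langlands.SatakeFrobCompatibleAt ι π.1 σ w :=
    hpi.mono fun w hw => (satakeFrobCompatibleAt_iff_of_dual_transport ι σ τ hτ π.1 w).2 hw
  exact ⟨hcpt, π, fun w hw =>
    satakeFrobCompatibleAt_of_eventually_of_isUnramifiedAt hG K p ι σ hfin hcpt π hae w hw⟩

end Summit.Langlands.Langlands.Theorems.ArtinWeightRealisationLevel

end
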